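/-
Copyright: lit-balaban cell (HOME `run/shared/lean/pub/lit-balaban/`), Phase-2 proof seat p12 (gen 7).  The proofs reproduce the
printed arguments; nothing is claimed beyond what the kernel checks below.
-/
import Literature.MathematicalPhysics.QuantumFieldTheory.DybalskiStottmeisterTanimoto2024.DST24GreenFunction

/-!
# `DybalskiStottmeisterTanimoto2024.DST24LaplacianBounds` — [DybalskiStottmeisterTanimoto2024] **§4.2 Lemma (inverse-lemma) 2.–3.
# with explicit constants**: (bounded-Laplacian) `‖∂f‖² ≤ 8‖f‖²`, `‖∂*g‖² ≤ 8‖g‖²`, `‖(−Δ_Ω + Q*Q)f‖² ≤ 130‖f‖²`, hence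
# (Green-estimate) `Γ ≥ c` and (sandwiched-Green) `QΓQ* ≥ c` with `c = (1040L⁴)⁻¹`, uniformly in `n`

statement-level skeleton of published theorems with citation tags; proofs where landed; nothing here is a claim about
the Yang–Mills mass gap

W. Dybalski, A. Stottmeister, Y. Tanimoto, *The Bałaban variational problem in the non-linear sigma model*, Rev. Math. Phys.
**36** (2024), arXiv:2403.09800; source held `paper:arxiv-2403.09800` (§4.2 Lemma (inverse-lemma) = tex chunks p0012–p0013).
Unit `lit-balaban-p12` (gen 7); `Γ`, (many-boxes) from `DST24GreenFunction`.

WHAT IS PRINTED AND PROVED HERE.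
* (bounded-Laplacian) «we use that on a unit lattice `‖Δ_Ω‖_{2,2;Ω} ≤ 4` and `Q*Q` has norm one as a projection» — here in the form
  `⟨∂f, ∂f⟩ ≤ 8⟨f, f⟩` (`ipB_del_le`; each site lies on at most `4` bonds), `⟨∂*g, ∂*g⟩ ≤ 8⟨g, g⟩` (`ipS_delStar_le`), `⟨Q*Qf, Q*Qf⟩ ≤
  ⟨f, f⟩` (`ipS_QstarQ_le`), so `‖(−Δ_Ω + Q*Q)f‖² ≤ 130‖f‖²` (`ipS_Mfun_Mfun_le`).  (The constant `4` of the print is the sharp bound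
  for `‖Δ_Ω‖` in `d = 1`; in `d = 2` the spectrum of `−Δ` reaches `8`; only some `n`-independent constant matters.)
* Lemma (inverse-lemma) 2. (Green-estimate) «`(−Δ_Ω + Q*Q)⁻¹ ≥ c`», 3. (sandwiched-Green) «`Q(−Δ_Ω + Q*Q)⁻¹Q* ≥ c`», «`c > 0`
  independent of `n`» — `green_estimate`, `sandwiched_green` with `c = (1040L⁴)⁻¹` (the print's argument: `M ≥ C` and `‖M‖ ≤ C′`
  give `M⁻¹ ≥ C/C′²`; then «if a Hermitian `M` satisfies `M ≥ c` on `𝓛²(Ω)`, then `QMQ* ≥ c` on `𝓛²(Ω₁)` … since `QQ* = 1`»).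
-/

namespace Literature.MathematicalPhysics.QuantumFieldTheory.DybalskiStottmeisterTanimoto2024.DST24LaplacianBounds

open scoped Quaternion RealInnerProductSpace BigOperators
open Literature.MathematicalPhysics.QuantumFieldTheory.Federbush1986
open Literature.MathematicalPhysics.QuantumFieldTheory.DybalskiStottmeisterTanimoto2024.DST24Setting
open Literature.MathematicalPhysics.QuantumFieldTheory.DybalskiStottmeisterTanimoto2024.DST24Configurations
open Literature.MathematicalPhysics.QuantumFieldTheory.DybalskiStottmeisterTanimoto2024.DST24LinearConstraint
open Literature.MathematicalPhysics.QuantumFieldTheory.DybalskiStottmeisterTanimoto2024.DST24TangentSpace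
open Literature.MathematicalPhysics.QuantumFieldTheory.DybalskiStottmeisterTanimoto2024.DST24CriticalPoint
open Literature.MathematicalPhysics.QuantumFieldTheory.DybalskiStottmeisterTanimoto2024.DST24GreenFunction

noncomputable section

variable {L n₁ : ℕ}

/-! ## Bond combinatorics: each site is the source of ≤ 2 bonds and the target of ≤ 2 bonds -/

/-- A bond is determined by its target and its direction. [cite: DybalskiStottmeisterTanimoto2024, §1.1 («oriented bonds `b = (b₋, b₊)`»)] -/
theorem Bond.ext_of_tgt_dir {b b' : Bond L n₁} (ht : b.tgt = b'.tgt) (hd : b.dir = b'.dir) : b = b' := by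
  have hsrc : b.src = b'.src := by
    funext ν
    by_cases hν : ν = b.dir
    · apply Fin.ext
      have h1 := b.tgt_apply_dir
      have h2 := b'.tgt_apply_dir
      rw [← hd, ← ht] at h2
      subst hν
      omega
    · have h1 := b.tgt_apply_of_ne hν
      have h2 := b'.tgt_apply_of_ne (hd ▸ hν)
      rw [← ht] at h2
      rw [← h1, h2]
  rcases b with ⟨⟨s, d⟩, hb⟩
  rcases b' with ⟨⟨s', d'⟩, hb'⟩
  simp only [Subtype.mk.injEq, Prod.mk.injEq]
  exact ⟨hsrc, hd⟩

/-- A bond is determined by its source and its direction. [cite: DybalskiStottmeisterTanimoto2024, §1.1 («oriented bonds»)] -/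
theorem Bond.ext_of_src_dir {b b' : Bond L n₁} (hs : b.src = b'.src) (hd : b.dir = b'.dir) : b = b' := by
  rcases b with ⟨⟨s, d⟩, hb⟩
  rcases b' with ⟨⟨s', d'⟩, hb'⟩
  simp only [Subtype.mk.injEq, Prod.mk.injEq]
  exact ⟨hs, hd⟩

/-- At most `2` bonds start at a site. [cite: DybalskiStottmeisterTanimoto2024, §4.2 (bounded-Laplacian)] -/
theorem card_src_fiber_le (x : Site L n₁) : (Finset.univ.filter fun b : Bond L n₁ => b.src = x).card ≤ 2 := by
  have h := Finset.card_le_card_of_injOn (s := Finset.univ.filter fun b : Bond L n₁ => b.src = x) (t := (Finset.univ : Finset (Fin 2)))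
    Bond.dir (fun _ _ => Finset.mem_coe.mpr (Finset.mem_univ _)) (fun b hb b' hb' hd => by
      simp only [Finset.coe_filter, Finset.mem_univ, true_and, Set.mem_setOf_eq] at hb hb'
      exact Bond.ext_of_src_dir (hb.trans hb'.symm) hd)
  simpa using h

/-- At most `2` bonds end at a site. [cite: DybalskiStottmeisterTanimoto2024, §4.2 (bounded-Laplacian)] -/
theorem card_tgt_fiber_le (x : Site L n₁) : (Finset.univ.filter fun b : Bond L n₁ => b.tgt = x).card ≤ 2 := by
  have h := Finset.card_le_card_of_injOn (s := Finset.univ.filter fun b : Bond L n₁ => b.tgt = x) (t := (Finset.univ : Finset (Fin 2)))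
    Bond.dir (fun _ _ => Finset.mem_coe.mpr (Finset.mem_univ _)) (fun b hb b' hb' hd => by
      simp only [Finset.coe_filter, Finset.mem_univ, true_and, Set.mem_setOf_eq] at hb hb'
      exact Bond.ext_of_tgt_dir (hb.trans hb'.symm) hd)
  simpa using h

section Bounds

variable {E : Type*} [NormedAddCommGroup E] [InnerProductSpace ℝ E]

/-- `Σ_b φ(b₋) ≤ 2 Σ_x φ(x)` for `φ ≥ 0`. [cite: DybalskiStottmeisterTanimoto2024, §4.2 (bounded-Laplacian)] -/
theorem sum_src_le (φ : Site L n₁ → ℝ) (hφ : ∀ x, 0 ≤ φ x) : ∑ b : Bond L n₁, φ b.src ≤ 2 * ∑ x, φ x := by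
  rw [← Finset.sum_fiberwise Finset.univ Bond.src (fun b => φ b.src), Finset.mul_sum]
  refine Finset.sum_le_sum fun x _ => ?_
  have e : ∑ b ∈ Finset.univ.filter (fun b : Bond L n₁ => b.src = x), φ b.src =
      ∑ b ∈ Finset.univ.filter (fun b : Bond L n₁ => b.src = x), φ x :=
    Finset.sum_congr rfl fun b hb => by rw [(Finset.mem_filter.mp hb).2]
  rw [e, Finset.sum_const, nsmul_eq_mul]
  exact mul_le_mul_of_nonneg_right (by exact_mod_cast card_src_fiber_le x) (hφ x)

/-- `Σ_b φ(b₊) ≤ 2 Σ_x φ(x)` for `φ ≥ 0`. [cite: DybalskiStottmeisterTanimoto2024, §4.2 (bounded-Laplacian)] -/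
theorem sum_tgt_le (φ : Site L n₁ → ℝ) (hφ : ∀ x, 0 ≤ φ x) : ∑ b : Bond L n₁, φ b.tgt ≤ 2 * ∑ x, φ x := by
  rw [← Finset.sum_fiberwise Finset.univ Bond.tgt (fun b => φ b.tgt), Finset.mul_sum]
  refine Finset.sum_le_sum fun x _ => ?_
  have e : ∑ b ∈ Finset.univ.filter (fun b : Bond L n₁ => b.tgt = x), φ b.tgt =
      ∑ b ∈ Finset.univ.filter (fun b : Bond L n₁ => b.tgt = x), φ x :=
    Finset.sum_congr rfl fun b hb => by rw [(Finset.mem_filter.mp hb).2]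
  rw [e, Finset.sum_const, nsmul_eq_mul]
  exact mul_le_mul_of_nonneg_right (by exact_mod_cast card_tgt_fiber_le x) (hφ x)

/-- `⟨g, g⟩_{Ω′} = Σ_b ‖g(b)‖²`. [cite: DybalskiStottmeisterTanimoto2024, Notation] -/
theorem ipB_self (g : Bond L n₁ → E) : ipB g g = ∑ b, ‖g b‖ ^ 2 := by
  unfold ipB; simp only [real_inner_self_eq_norm_sq]

/-- (bounded-Laplacian), first half: `⟨∂f, ∂f⟩_{Ω′} ≤ 8⟨f, f⟩_Ω` (i.e. `−Δ_Ω ≤ 8`). [cite: DybalskiStottmeisterTanimoto2024, §4.2 (bounded-Laplacian)] -/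
theorem ipB_del_le (f : Site L n₁ → E) : ipB (del f) (del f) ≤ 8 * ipS f f := by
  rw [ipB_self, ipS_self]
  have h1 : ∀ b : Bond L n₁, ‖del f b‖ ^ 2 ≤ 2 * ‖f b.src‖ ^ 2 + 2 * ‖f b.tgt‖ ^ 2 := fun b => by
    rw [del_apply]
    have := norm_sub_le (f b.src) (f b.tgt)
    nlinarith [sq_nonneg (‖f b.src‖ - ‖f b.tgt‖), norm_nonneg (f b.src - f b.tgt), norm_nonneg (f b.src), norm_nonneg (f b.tgt)]
  calc ∑ b, ‖del f b‖ ^ 2 ≤ ∑ b : Bond L n₁, (2 * ‖f b.src‖ ^ 2 + 2 * ‖f b.tgt‖ ^ 2) := Finset.sum_le_sum fun b _ => h1 b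
    _ = 2 * ∑ b : Bond L n₁, ‖f b.src‖ ^ 2 + 2 * ∑ b : Bond L n₁, ‖f b.tgt‖ ^ 2 := by
        rw [Finset.sum_add_distrib, Finset.mul_sum, Finset.mul_sum]
    _ ≤ 2 * (2 * ∑ x, ‖f x‖ ^ 2) + 2 * (2 * ∑ x, ‖f x‖ ^ 2) :=
        add_le_add (mul_le_mul_of_nonneg_left (sum_src_le (fun x => ‖f x‖ ^ 2) fun _ => sq_nonneg _) (by norm_num))
          (mul_le_mul_of_nonneg_left (sum_tgt_le (fun x => ‖f x‖ ^ 2) fun _ => sq_nonneg _) (by norm_num))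
    _ = 8 * ∑ x, ‖f x‖ ^ 2 := by ring

omit [InnerProductSpace ℝ E] in
/-- `‖Σ_{b: b₋ = x} g(b)‖² ≤ 2 Σ_{b: b₋ = x} ‖g(b)‖²` (at most two terms). [cite: DybalskiStottmeisterTanimoto2024, §4.2 (bounded-Laplacian)] -/
theorem norm_sq_fiber_sum_le (g : Bond L n₁ → E) (p : Bond L n₁ → Site L n₁) (x : Site L n₁)
    (hcard : (Finset.univ.filter fun b : Bond L n₁ => p b = x).card ≤ 2) :
    ‖∑ b ∈ Finset.univ.filter (fun b : Bond L n₁ => p b = x), g b‖ ^ 2 ≤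
      2 * ∑ b ∈ Finset.univ.filter (fun b : Bond L n₁ => p b = x), ‖g b‖ ^ 2 := by
  set s := Finset.univ.filter (fun b : Bond L n₁ => p b = x)
  have h1 : ‖∑ b ∈ s, g b‖ ^ 2 ≤ (∑ b ∈ s, ‖g b‖) ^ 2 := pow_le_pow_left₀ (norm_nonneg _) (norm_sum_le _ _) 2
  have h2 : (∑ b ∈ s, ‖g b‖) ^ 2 ≤ s.card * ∑ b ∈ s, ‖g b‖ ^ 2 := sq_sum_le_card_mul_sum_sq
  have h3 : (s.card : ℝ) * ∑ b ∈ s, ‖g b‖ ^ 2 ≤ 2 * ∑ b ∈ s, ‖g b‖ ^ 2 :=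
    mul_le_mul_of_nonneg_right (by exact_mod_cast hcard) (Finset.sum_nonneg fun _ _ => sq_nonneg _)
  linarith

/-- (bounded-Laplacian), second half: `⟨∂*g, ∂*g⟩_Ω ≤ 8⟨g, g⟩_{Ω′}`. [cite: DybalskiStottmeisterTanimoto2024, §4.2 (bounded-Laplacian)] -/
theorem ipS_delStar_le (g : Bond L n₁ → E) : ipS (delStar g) (delStar g) ≤ 8 * ipB g g := by
  rw [ipB_self, ipS_self]
  have hS : ∀ (p : Bond L n₁ → Site L n₁) (x : Site L n₁),
      (∑ b : Bond L n₁, if p b = x then g b else 0) = ∑ b ∈ Finset.univ.filter (fun b : Bond L n₁ => p b = x), g b :=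
    fun p x => (Finset.sum_filter _ _).symm
  have h1 : ∀ x : Site L n₁, ‖delStar g x‖ ^ 2 ≤
      4 * ∑ b ∈ Finset.univ.filter (fun b : Bond L n₁ => b.src = x), ‖g b‖ ^ 2 +
        4 * ∑ b ∈ Finset.univ.filter (fun b : Bond L n₁ => b.tgt = x), ‖g b‖ ^ 2 := fun x => by
    rw [delStar_apply, hS Bond.src x, hS Bond.tgt x]
    have ha := norm_sq_fiber_sum_le g Bond.src x (card_src_fiber_le x)
    have hb := norm_sq_fiber_sum_le g Bond.tgt x (card_tgt_fiber_le x)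
    have hsub := norm_sub_le (∑ b ∈ Finset.univ.filter (fun b : Bond L n₁ => b.src = x), g b)
      (∑ b ∈ Finset.univ.filter (fun b : Bond L n₁ => b.tgt = x), g b)
    nlinarith [norm_nonneg (∑ b ∈ Finset.univ.filter (fun b : Bond L n₁ => b.src = x), g b -
        ∑ b ∈ Finset.univ.filter (fun b : Bond L n₁ => b.tgt = x), g b),
      norm_nonneg (∑ b ∈ Finset.univ.filter (fun b : Bond L n₁ => b.src = x), g b),
      norm_nonneg (∑ b ∈ Finset.univ.filter (fun b : Bond L n₁ => b.tgt = x), g b),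
      sq_nonneg (‖∑ b ∈ Finset.univ.filter (fun b : Bond L n₁ => b.src = x), g b‖ -
        ‖∑ b ∈ Finset.univ.filter (fun b : Bond L n₁ => b.tgt = x), g b‖)]
  calc ∑ x, ‖delStar g x‖ ^ 2
      ≤ ∑ x : Site L n₁, (4 * ∑ b ∈ Finset.univ.filter (fun b : Bond L n₁ => b.src = x), ‖g b‖ ^ 2 +
          4 * ∑ b ∈ Finset.univ.filter (fun b : Bond L n₁ => b.tgt = x), ‖g b‖ ^ 2) := Finset.sum_le_sum fun x _ => h1 x
    _ = 4 * ∑ b, ‖g b‖ ^ 2 + 4 * ∑ b, ‖g b‖ ^ 2 := by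
        rw [Finset.sum_add_distrib, ← Finset.mul_sum, ← Finset.mul_sum,
          Finset.sum_fiberwise Finset.univ Bond.src (fun b => ‖g b‖ ^ 2),
          Finset.sum_fiberwise Finset.univ Bond.tgt (fun b => ‖g b‖ ^ 2)]
    _ = 8 * ∑ b, ‖g b‖ ^ 2 := by ring

/-- «`Q*Q` has norm one as a projection»: `⟨Q*Qf, Q*Qf⟩_Ω ≤ ⟨f, f⟩_Ω`. [cite: DybalskiStottmeisterTanimoto2024, §4.2 (bounded-Laplacian) («`Q*Q` has norm one as a projection»)] -/
theorem ipS_QstarQ_le (hL : 0 < L) (f : Site L n₁ → E) : ipS (Qstar L (Q L f)) (Qstar L (Q L f)) ≤ ipS f f := by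
  -- `0 ≤ ⟨f − Q*Qf, f − Q*Qf⟩ = ⟨f,f⟩ − ⟨Q*Qf, Q*Qf⟩`
  have h0 : 0 ≤ ipS (f - Qstar L (Q L f)) (f - Qstar L (Q L f)) := by
    rw [ipS_self]; exact Finset.sum_nonneg fun _ _ => sq_nonneg _
  have e1 : ipS (Qstar L (Q L f)) (Qstar L (Q L f)) = ipS f (Qstar L (Q L f)) := by
    rw [← ipC_Q_eq_ipS_Qstar hL, ← ipC_Q_eq_ipS_Qstar hL, Q_Qstar hL]
  have e2 : ipS (f - Qstar L (Q L f)) (f - Qstar L (Q L f)) = ipS f f - ipS (Qstar L (Q L f)) (Qstar L (Q L f)) := by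
    unfold ipS at *
    simp only [Pi.sub_apply, inner_sub_left, inner_sub_right, Finset.sum_sub_distrib] at *
    have ec : ∑ x, ⟪Qstar L (Q L f) x, f x⟫ = ∑ x, ⟪f x, Qstar L (Q L f) x⟫ :=
      Finset.sum_congr rfl fun x _ => real_inner_comm _ _
    rw [ec, ← e1]
    ring
  linarith

/-- `‖(−Δ_Ω + Q*Q)f‖² ≤ 130‖f‖²` («`‖Δ_Ω‖ ≤ 4` and `Q*Q` has norm one», with the constants of this file).
[cite: DybalskiStottmeisterTanimoto2024, §4.2 (bounded-Laplacian), proof of (Green-estimate)] -/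
theorem ipS_Mfun_Mfun_le (hL : 0 < L) (f : Site L n₁ → E) : ipS (Mfun L f) (Mfun L f) ≤ 130 * ipS f f := by
  have hA : ipS (delStar (del f)) (delStar (del f)) ≤ 64 * ipS f f :=
    (ipS_delStar_le (del f)).trans (by nlinarith [ipB_del_le f])
  have hB := ipS_QstarQ_le hL f
  -- `‖a + b‖² ≤ 2‖a‖² + 2‖b‖²` sitewise
  have hsum : ipS (Mfun L f) (Mfun L f) ≤ 2 * ipS (delStar (del f)) (delStar (del f)) + 2 * ipS (Qstar L (Q L f)) (Qstar L (Q L f)) := by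
    rw [ipS_self, ipS_self, ipS_self, Finset.mul_sum, Finset.mul_sum, ← Finset.sum_add_distrib]
    refine Finset.sum_le_sum fun x _ => ?_
    unfold Mfun
    rw [Pi.add_apply]
    have := norm_add_le (delStar (del f) x) (Qstar L (Q L f) x)
    nlinarith [norm_nonneg (delStar (del f) x + Qstar L (Q L f) x), norm_nonneg (delStar (del f) x),
      norm_nonneg (Qstar L (Q L f) x), sq_nonneg (‖delStar (del f) x‖ - ‖Qstar L (Q L f) x‖)]
  linarith

variable [FiniteDimensional ℝ E]

/-- **Lemma (inverse-lemma) 2. (Green-estimate)** with explicit constant: «`(−Δ_Ω + Q*Q)⁻¹ ≥ c`», here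
`⟨g, Γg⟩_Ω ≥ (1040L⁴)⁻¹⟨g, g⟩_Ω`, uniformly in `n`. [cite: DybalskiStottmeisterTanimoto2024, §4.2 Lemma (inverse-lemma) 2. (Green-estimate)] -/
theorem green_estimate (hL : 0 < L) (g : Site L n₁ → E) : ipS g g ≤ 1040 * (L : ℝ) ^ 4 * ipS g (Gamma hL g) := by
  have key : ∀ f : Site L n₁ → E, ipS (Mfun L f) (Mfun L f) ≤ 1040 * (L : ℝ) ^ 4 * ipS (Mfun L f) f := fun f => by
    have h1 := many_boxes hL f
    have h2 := ipS_Mfun_Mfun_le hL f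
    rw [ipS_comm (Mfun L f) f]
    nlinarith
  have h := key (Gamma hL g)
  rwa [Mfun_Gamma] at h

/-- **Lemma (inverse-lemma) 3. (sandwiched-Green)** with explicit constant: «`Q(−Δ_Ω + Q*Q)⁻¹Q* ≥ c` on `𝓛²(Ω₁)`», here
`⟨c, QΓQ*c⟩_{Ω₁} ≥ (1040L⁴)⁻¹⟨c, c⟩_{Ω₁}` («since `QQ* = 1`»). [cite: DybalskiStottmeisterTanimoto2024, §4.2 Lemma (inverse-lemma) 3. (sandwiched-Green)] -/
theorem sandwiched_green (hL : 0 < L) (c : CSite n₁ → E) :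
    ipC L c c ≤ 1040 * (L : ℝ) ^ 4 * ipC L (Q L (Gamma hL (Qstar L c))) c := by
  rw [ipC_Q_eq_ipS_Qstar hL, ipS_comm]
  have h := green_estimate hL (Qstar L c)
  have e : ipS (Qstar L c) (Qstar L c) = ipC L c c := by
    rw [← ipC_Q_eq_ipS_Qstar hL, Q_Qstar hL]
  rw [← e]
  exact h

end Bounds

end

end Literature.MathematicalPhysics.QuantumFieldTheory.DybalskiStottmeisterTanimoto2024.DST24LaplacianBounds
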